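import Literature.MathematicalPhysics.KineticTheory.HardSphereUntaggedSubsystem
import Literature.MathematicalPhysics.KineticTheory.HardSphereBBGKYLiouvilleEstimate
import Literature.MathematicalPhysics.KineticTheory.GoodConfigurations
import Literature.MathematicalPhysics.KineticTheory.HardSphereDuhamelNullSets
import HarnessLib

/-!
# The trace of the transported marginals along the backward cluster flow: decoupling of the
# tagged and untagged dynamics over short times
(Cercignani–Illner–Pulvirenti 1994 §4.3 and App. 4.B (the marginal `P^{(s)}(T^{(s)}_{-u} z, t - u)`
read along the `s`-particle flow differs from `P^{(s)}(z, t)` by the contribution of the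
tagged–untagged collisions in a time `u`, of measure `O(u)`); Spohn 2006 §2; BGSR 2016 §3.1
Remark 3.1; trunk T-KINETIC, topic MathematicalPhysics/KineticTheory; towards the contact-trace
form (H1♯) of the one-step hierarchy from its generic form (H1), `TaggedSphereOneStepInputs`.)

For `s + m` hard spheres on `T^d` with regularised flows `Φ^s`, `Φ^m`, `Φ^{s+m}`, a
Gaussian-bounded datum `F₀` on the `(s+m)`-phase space transported along `Φ^{s+m}`
(`F_t = 1_{good} F₀ ∘ Φ^{s+m}_{-t}`) and its tagged marginal `f(t, W) = ∫ F_t(W, Z) dZ`, we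
PROVE the short-time decoupling estimate

  `|f(τ - u, Φ^s_{-u} W) - f(τ, W)| ≤ 2 C A u e^{-(β/2) E(W)}`     (`u ≥ 0`)

for every good `W` whose backward image `Φ^s_{-u} W` has a good fibre (almost every untagged
`Z` gives a good `(s+m)`-configuration) — the quantitative form of the continuity of the
marginal along the tagged flow across a tagged contact, from the outgoing side. Proof:
`F_{τ-u} = F_τ ∘ Φ^{s+m}_u` everywhere and `dZ` is `Φ^m_u`-invariant, so the difference is
`∫ [F_τ(Φ^{s+m}_u(Φ^s_{-u}W, Z)) - F_τ(W, Φ^m_u Z)] dZ`; the integrand vanishes unless some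
tagged–untagged pair of `(Φ^s_{-u}W, Z)`, resp. of `(W, Φ^m_u Z)`, lies in the collision window
of width `2u√(2E)` (DECOUPLING: if along the decoupled evolution all tagged–untagged distances
stay `> ε` then the `(s+m)`-orbit IS the decoupled evolution — `HardSphereFlow.tagged_flow_eq`,
`HardSphereFlow.untagged_flow_eq` up to the first cross contact, which continuity of the
distances then excludes), and the Gaussian volume of the window is `O(u)`
(`lintegral_window_le`, `HardSphereBBGKYLiouvilleWindow`).

* §1 `HardSphereFlow.euclidDist_flow_self_le` — a particle moves by at most `√(2E) |t₂ - t₁|`;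
* §2 `abs_decoupledDist_sub_le` — tagged–untagged distances of the decoupled evolution are
  `2√(2E)`-Lipschitz;
* §3 `HardSphereFlow.flow_append_eq_of_decoupled` — **the decoupling lemma**;
* §4 `transportedDatum_regFlow`, the pointwise comparison `abs_sub_le_indicator_window`;
* §5 `abs_marginal_backward_sub_le` — **the estimate**.

## References

* C. Cercignani, R. Illner, M. Pulvirenti, *The Mathematical Theory of Dilute Gases*, Springer
  (1994), §4.3, App. 4.B.
* H. Spohn, *On the integrated form of the BBGKY hierarchy for hard spheres*,
  arXiv:math-ph/0605068, §2.
* T. Bodineau, I. Gallagher, L. Saint-Raymond, Invent. Math. 203 (2016), arXiv:1305.3397v2,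
  §3.1 Remark 3.1 p. 9.
-/

open MeasureTheory Metric Real Set Filter Function Topology
open scoped InnerProductSpace ENNReal
open Literature.Analysis.FluidPDE

namespace Literature.MathematicalPhysics.KineticTheory

noncomputable section

variable {d : Type*} [Fintype d]

/-! ## §1. A particle moves by at most `√(2E) |t₂ - t₁|` along a good orbit -/

section Displacement

variable {ε : ℝ} {N : ℕ}

/-- **Single-particle displacement along a good orbit** (torus): for `t₁ ≤ t₂`, the
minimal-image distance between the positions of particle `i` at times `t₂` and `t₁` is at most
`√(2E(z)) (t₂ - t₁)` (free flight moves `x_i` by `(t₂-t₁) v_i`, `‖v_i‖ ≤ √(2E)`; positions are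
continuous across the locally finitely many collisions; continuous induction). [folklore] -/
theorem _root_.Literature.Analysis.FluidPDE.HardSphereFlow.euclidDist_flow_self_le
    (Φ : HardSphereFlow (Torus.geometry d) ε N) {z : Config N d (UnitAddTorus d)} (hz : z ∈ Φ.good)
    (i : Fin N) {t₁ t₂ : ℝ} (h12 : t₁ ≤ t₂) :
    Torus.euclidDist (Φ.flow t₂ z i).1 (Φ.flow t₁ z i).1 ≤ Real.sqrt (2 * configEnergy z) * (t₂ - t₁) := by
  have hγ := Φ.isTrajectory z hz
  set V : ℝ := Real.sqrt (2 * configEnergy z) with hV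
  set P : ℝ → UnitAddTorus d := fun t => (Φ.flow t z i).1 with hP
  have hPc : Continuous P := hγ.pos_continuous i
  set S : Set ℝ := {t | Torus.euclidDist (P t) (P t₁) ≤ V * (t - t₁)} with hS
  have hSc : IsClosed S := by
    have h1 : Continuous fun t => Torus.euclidDist (P t) (P t₁) := by
      simpa only [Function.comp_def] using Torus.continuous_euclidDist.comp (hPc.prodMk continuous_const)
    have h2 : Continuous fun t => V * (t - t₁) := by fun_prop
    exact isClosed_le h1 h2
  have hmem : t₁ ∈ S := by simp [hS, Torus.euclidDist_self]
  have key : Icc t₁ t₂ ⊆ S := by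
    refine (hSc.inter isClosed_Icc).Icc_subset_of_forall_mem_nhdsWithin hmem ?_
    rintro x ⟨hxS, hx⟩
    obtain ⟨u, hxu, hfree⟩ := hγ.exists_Ioo_right_free x
    refine mem_of_superset (Ioo_mem_nhdsGT hxu) fun t ht => ?_
    have hff : Φ.flow t z = freeFlight (Torus.geometry d) (t - x) (Φ.flow x z) :=
      hγ.eq_freeFlight_of_Ioo_free hfree ⟨ht.1.le, ht.2⟩
    have hstep : Torus.euclidDist (P t) (P x) ≤ V * (t - x) := by
      have h := Torus.euclidDist_translate_le (Φ.flow x z i).1 (Φ.flow x z i).1 ((t - x) • (Φ.flow x z i).2) 0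
      rw [Torus.euclidDist_self, zero_add, sub_zero, norm_smul, Real.norm_of_nonneg (sub_nonneg.2 ht.1.le),
        Literature.Analysis.FunctionSpaces.Torus.proj_zero, add_zero] at h
      have hvi := Φ.norm_vel_flow_le hz x i
      have hPt : P t = (Φ.flow x z i).1 + Literature.Analysis.FunctionSpaces.Torus.proj ((t - x) • (Φ.flow x z i).2) := by
        show (Φ.flow t z i).1 = _
        rw [hff, freeFlight_apply, Torus.geometry_translate]
      rw [hPt]
      calc _ ≤ (t - x) * ‖(Φ.flow x z i).2‖ := h
        _ ≤ (t - x) * V := by gcongr; linarith [ht.1]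
        _ = V * (t - x) := by ring
    show Torus.euclidDist (P t) (P t₁) ≤ V * (t - t₁)
    have hxS' : Torus.euclidDist (P x) (P t₁) ≤ V * (x - t₁) := hxS
    calc Torus.euclidDist (P t) (P t₁) ≤ Torus.euclidDist (P t) (P x) + Torus.euclidDist (P x) (P t₁) :=
          torus_euclidDist_triangle _ _ _
      _ ≤ V * (t - x) + V * (x - t₁) := add_le_add hstep hxS'
      _ = V * (t - t₁) := by ring
  exact key ⟨h12, le_rfl⟩

/-- The same with the two times free: `dist(x_i(t), x_i(t')) ≤ √(2E) |t - t'|`. [folklore] -/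
theorem _root_.Literature.Analysis.FluidPDE.HardSphereFlow.euclidDist_flow_self_le'
    (Φ : HardSphereFlow (Torus.geometry d) ε N) {z : Config N d (UnitAddTorus d)} (hz : z ∈ Φ.good)
    (i : Fin N) (t t' : ℝ) :
    Torus.euclidDist (Φ.flow t z i).1 (Φ.flow t' z i).1 ≤ Real.sqrt (2 * configEnergy z) * |t - t'| := by
  rcases le_total t' t with h | h
  · rw [abs_of_nonneg (sub_nonneg.2 h)]
    exact Φ.euclidDist_flow_self_le hz i h
  · rw [abs_sub_comm, abs_of_nonneg (sub_nonneg.2 h), Torus.euclidDist_comm]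
    exact Φ.euclidDist_flow_self_le hz i h

end Displacement

/-! ## §2. Tagged–untagged distances of the decoupled evolution are Lipschitz -/

section Decoupled

variable {ε : ℝ} {s m : ℕ}

/-- The sum of the energies of the blocks is the energy of the juxtaposition, so
`√(2E(w)) + √(2E(Z)) ≤ 2 √(2 E(w, Z))`. [folklore] -/
theorem sqrt_add_sqrt_le_two_sqrt_append (w : Config s d (UnitAddTorus d)) (Zm : Config m d (UnitAddTorus d)) :
    Real.sqrt (2 * configEnergy w) + Real.sqrt (2 * configEnergy Zm) ≤
      2 * Real.sqrt (2 * configEnergy (Fin.append w Zm)) := by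
  rw [configEnergy_append]
  have hw : 0 ≤ configEnergy w := by unfold configEnergy; positivity
  have hZ : 0 ≤ configEnergy Zm := by unfold configEnergy; positivity
  have h1 : Real.sqrt (2 * configEnergy w) ≤ Real.sqrt (2 * (configEnergy w + configEnergy Zm)) :=
    Real.sqrt_le_sqrt (by linarith)
  have h2 : Real.sqrt (2 * configEnergy Zm) ≤ Real.sqrt (2 * (configEnergy w + configEnergy Zm)) :=
    Real.sqrt_le_sqrt (by linarith)
  linarith

/-- **The tagged–untagged distances of the decoupled evolution are `2√(2E)`-Lipschitz**: along
`σ ↦ (Φ^s_σ w, Φ^m_σ Z)` (each block following its own flow, good data), the minimal-image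
distance between tagged particle `I` and untagged particle `j` changes by at most
`2√(2E(w, Z)) |σ - σ'|` (each particle moves by at most `√(2E_block) |σ - σ'|`, triangle
inequality). [folklore] -/
theorem abs_decoupledDist_sub_le (Φs : HardSphereFlow (Torus.geometry d) ε s)
    (Φm : HardSphereFlow (Torus.geometry d) ε m) {w : Config s d (UnitAddTorus d)} (hw : w ∈ Φs.good)
    {Zm : Config m d (UnitAddTorus d)} (hZ : Zm ∈ Φm.good) (I : Fin s) (j : Fin m) (σ σ' : ℝ) :
    |Torus.euclidDist (Φs.flow σ w I).1 (Φm.flow σ Zm j).1 -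
        Torus.euclidDist (Φs.flow σ' w I).1 (Φm.flow σ' Zm j).1| ≤
      2 * Real.sqrt (2 * configEnergy (Fin.append w Zm)) * |σ - σ'| := by
  have h1 := Φs.euclidDist_flow_self_le' hw I σ σ'
  have h2 := Φm.euclidDist_flow_self_le' hZ j σ σ'
  have hsum := sqrt_add_sqrt_le_two_sqrt_append w Zm
  have habs : 0 ≤ |σ - σ'| := abs_nonneg _
  -- triangle inequalities
  have t1 : Torus.euclidDist (Φs.flow σ w I).1 (Φm.flow σ Zm j).1 ≤
      Torus.euclidDist (Φs.flow σ w I).1 (Φs.flow σ' w I).1 +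
        (Torus.euclidDist (Φs.flow σ' w I).1 (Φm.flow σ' Zm j).1 +
          Torus.euclidDist (Φm.flow σ' Zm j).1 (Φm.flow σ Zm j).1) :=
    (torus_euclidDist_triangle _ _ _).trans (add_le_add le_rfl (torus_euclidDist_triangle _ _ _))
  have t2 : Torus.euclidDist (Φs.flow σ' w I).1 (Φm.flow σ' Zm j).1 ≤
      Torus.euclidDist (Φs.flow σ' w I).1 (Φs.flow σ w I).1 +
        (Torus.euclidDist (Φs.flow σ w I).1 (Φm.flow σ Zm j).1 +
          Torus.euclidDist (Φm.flow σ Zm j).1 (Φm.flow σ' Zm j).1) :=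
    (torus_euclidDist_triangle _ _ _).trans (add_le_add le_rfl (torus_euclidDist_triangle _ _ _))
  rw [Torus.euclidDist_comm (Φm.flow σ' Zm j).1] at t1
  rw [Torus.euclidDist_comm (Φs.flow σ' w I).1 (Φs.flow σ w I).1] at t2
  rw [abs_sub_le_iff]
  constructor <;> nlinarith [h1, h2, hsum, habs, mul_nonneg (mul_nonneg zero_le_two (Real.sqrt_nonneg (2 * configEnergy (Fin.append w Zm)))) habs]

end Decoupled

/-! ## §3. The decoupling lemma -/

section DecouplingLemma

variable {ε : ℝ} {s m : ℕ}

/-- A tagged–untagged contact is a tagged–untagged pair at minimal-image distance exactly `ε`.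
[folklore] -/
theorem exists_euclidDist_eq_of_crossContact {z : Config (s + m) d (UnitAddTorus d)} {I J : Fin (s + m)}
    (hc : z ∈ contactSet (Torus.geometry d) (s + m) ε I J) (hx : ¬ ((I : ℕ) < s ↔ (J : ℕ) < s)) :
    ∃ (i : Fin s) (j : Fin m), Torus.euclidDist (z (Fin.castAdd m i)).1 (z (Fin.natAdd s j)).1 = ε := by
  have hd : Torus.euclidDist (z I).1 (z J).1 = ε := by
    rw [← Torus.norm_geometry_sepVec]; exact (mem_contactSet.1 hc).2
  rcases eq_castAdd_or_eq_natAdd I with ⟨i, rfl⟩ | ⟨i, rfl⟩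
  · rcases eq_castAdd_or_eq_natAdd J with ⟨j, rfl⟩ | ⟨j, rfl⟩
    · exfalso; apply hx; simp
    · exact ⟨i, j, hd⟩
  · rcases eq_castAdd_or_eq_natAdd J with ⟨j, rfl⟩ | ⟨j, rfl⟩
    · refine ⟨j, i, ?_⟩
      rw [Torus.euclidDist_comm]; exact hd
    · exfalso; apply hx; simp

/-- **The decoupling lemma.** Let `Φ^s`, `Φ^m`, `Φ^{s+m}` be hard-sphere flows on `T^d` (same
diameter), `w`, `Z` good data of the blocks with `(w, Z)` good for `Φ^{s+m}`, and `u ≥ 0`. If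
along the DECOUPLED evolution `σ ↦ (Φ^s_σ w, Φ^m_σ Z)` every tagged–untagged pair stays at
distance `> ε` on `[0, u]`, then on `[0, u]` the `(s+m)`-orbit of `(w, Z)` IS the decoupled
evolution. Proof: if the orbit had tagged–untagged contacts in `(0, u]`, take the first one,
`σ*` (locally finitely many collision times); before `σ*` the blocks follow their own flows
(`HardSphereFlow.tagged_flow_eq`, `HardSphereFlow.untagged_flow_eq`), and by continuity of the
distances the contact pair would be at distance `ε` also for the decoupled evolution at `σ*`,
contradicting the hypothesis; so there is no tagged–untagged contact on `(0, u]` and the two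
subsystem lemmas conclude. (CIP 1994 §4.3: between its collisions with the others, a group of
particles moves with its own dynamics.) [cite: CIP1994, §4.3 and App. 4.B] -/
theorem _root_.Literature.Analysis.FluidPDE.HardSphereFlow.flow_append_eq_of_decoupled
    (Φs : HardSphereFlow (Torus.geometry d) ε s) (Φm : HardSphereFlow (Torus.geometry d) ε m)
    (Φn : HardSphereFlow (Torus.geometry d) ε (s + m))
    {w : Config s d (UnitAddTorus d)} {Zm : Config m d (UnitAddTorus d)}
    (hy : Fin.append w Zm ∈ Φn.good) (hw : w ∈ Φs.good) (hZ : Zm ∈ Φm.good) {u : ℝ} (hu : 0 ≤ u)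
    (hsep : ∀ σ ∈ Icc 0 u, ∀ (I : Fin s) (j : Fin m),
      ε < Torus.euclidDist (Φs.flow σ w I).1 (Φm.flow σ Zm j).1) :
    ∀ σ ∈ Icc 0 u, Φn.flow σ (Fin.append w Zm) = Fin.append (Φs.flow σ w) (Φm.flow σ Zm) := by
  classical
  set y : Config (s + m) d (UnitAddTorus d) := Fin.append w Zm with hydef
  have hyw : (y ∘ Fin.castAdd m : Config s d (UnitAddTorus d)) = w := funext fun i => Fin.append_left w Zm i
  have hyZ : (y ∘ Fin.natAdd s : Config m d (UnitAddTorus d)) = Zm := funext fun j => Fin.append_right w Zm j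
  have hγn := Φn.isTrajectory y hy
  have hγs := Φs.isTrajectory w hw
  have hγm := Φm.isTrajectory Zm hZ
  have hG := Torus.continuous_geometry_translate (d := d)
  -- from "no cross contact on `(0, h]`" to the decoupled form on `[0, h]`
  have hdec : ∀ h : ℝ, (∀ τ ∈ Ioc 0 h, ∀ I J : Fin (s + m), I ≠ J →
      Φn.flow τ y ∈ contactSet (Torus.geometry d) (s + m) ε I J → ((I : ℕ) < s ↔ (J : ℕ) < s)) →
      ∀ σ ∈ Icc 0 h, Φn.flow σ y = Fin.append (Φs.flow σ w) (Φm.flow σ Zm) := by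
    intro h hnc σ hσ
    have ht := HardSphereFlow.tagged_flow_eq hG Φs Φn hy (by rw [hyw]; exact hw) hnc σ hσ
    have hut := HardSphereFlow.untagged_flow_eq hG Φm Φn hy (by rw [hyZ]; exact hZ) hnc σ hσ
    rw [hyw] at ht
    rw [hyZ] at hut
    calc Φn.flow σ y = Fin.append (Φn.flow σ y ∘ Fin.castAdd m) (Φn.flow σ y ∘ Fin.natAdd s) :=
          (Fin.append_castAdd_natAdd).symm
      _ = Fin.append (Φs.flow σ w) (Φm.flow σ Zm) := by rw [ht, hut]
  -- no cross contact on `(0, u]`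
  refine hdec u fun τ₀ hτ₀ I₀ J₀ hIJ₀ hc₀ => ?_
  by_contra hx₀
  -- the finite set of cross-contact times in `[0, u]`
  set T : Finset ℝ := ((hγn.locFinite 0 u).toFinset).filter fun τ => ∃ I J : Fin (s + m), I ≠ J ∧
      Φn.flow τ y ∈ contactSet (Torus.geometry d) (s + m) ε I J ∧ ¬ ((I : ℕ) < s ↔ (J : ℕ) < s) with hT
  have hmemT : ∀ {τ : ℝ}, τ ∈ T ↔ (τ ∈ collisionTimes (Torus.geometry d) ε (fun t => Φn.flow t y) ∧ τ ∈ Icc 0 u) ∧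
      ∃ I J : Fin (s + m), I ≠ J ∧ Φn.flow τ y ∈ contactSet (Torus.geometry d) (s + m) ε I J ∧
        ¬ ((I : ℕ) < s ↔ (J : ℕ) < s) := by
    intro τ
    rw [hT, Finset.mem_filter, Set.Finite.mem_toFinset]
    rfl
  have hτ₀T : τ₀ ∈ T := hmemT.2 ⟨⟨⟨I₀, J₀, hIJ₀, hc₀⟩, hτ₀.1.le, hτ₀.2⟩, I₀, J₀, hIJ₀, hc₀, hx₀⟩
  have hne : T.Nonempty := ⟨τ₀, hτ₀T⟩
  set σs : ℝ := T.min' hne with hσs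
  obtain ⟨⟨-, hσI⟩, I, J, hIJ, hc, hx⟩ := hmemT.1 (T.min'_mem hne)
  obtain ⟨i, j, hdist⟩ := exists_euclidDist_eq_of_crossContact hc hx
  -- `σs > 0`: at time `0` the configuration is `(w, Z)`, whose cross distances exceed `ε`
  have hσpos : 0 < σs := by
    refine lt_of_le_of_ne hσI.1 fun h0 => ?_
    have h00 : Φn.flow σs y = y := by rw [← h0]; exact Φn.flow_zero y hy
    rw [h00] at hdist
    have h1 := hsep 0 ⟨le_rfl, hu⟩ i j
    rw [Φs.flow_zero w hw, Φm.flow_zero Zm hZ] at h1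
    have h2 : Torus.euclidDist (y (Fin.castAdd m i)).1 (y (Fin.natAdd s j)).1 =
        Torus.euclidDist (w i).1 (Zm j).1 := by
      rw [hydef, Fin.append_left, Fin.append_right]
    linarith [h2.symm.trans hdist]
  -- before `σs` the orbit is decoupled
  have hbefore : ∀ σ' ∈ Ico 0 σs, Φn.flow σ' y = Fin.append (Φs.flow σ' w) (Φm.flow σ' Zm) := by
    intro σ' hσ'
    refine hdec σ' (fun τ hτ I' J' hIJ' hc' => ?_) σ' ⟨hσ'.1, le_rfl⟩
    by_contra hx'
    have hτT : τ ∈ T := hmemT.2 ⟨⟨⟨I', J', hIJ', hc'⟩, hτ.1.le, (hτ.2.trans hσ'.2.le).trans hσI.2⟩,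
      I', J', hIJ', hc', hx'⟩
    exact absurd (T.min'_le τ hτT) (not_le.2 (hτ.2.trans_lt hσ'.2))
  -- the two distance functions agree before `σs`, hence at `σs` by continuity
  set f : ℝ → ℝ := fun σ => Torus.euclidDist (Φn.flow σ y (Fin.castAdd m i)).1 (Φn.flow σ y (Fin.natAdd s j)).1 with hf
  set g : ℝ → ℝ := fun σ => Torus.euclidDist (Φs.flow σ w i).1 (Φm.flow σ Zm j).1 with hg
  have hfc : Continuous f := Φn.continuous_euclidDist_flow hy _ _
  have hgc : Continuous g := by
    have h2 : Continuous fun σ => ((Φs.flow σ w i).1, (Φm.flow σ Zm j).1) :=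
      (hγs.pos_continuous i).prodMk (hγm.pos_continuous j)
    simpa only [Function.comp_def] using Torus.continuous_euclidDist.comp h2
  have hfg : ∀ σ ∈ Ioo 0 σs, f σ = g σ := by
    intro σ hσ
    simp only [hf, hg, hbefore σ ⟨hσ.1.le, hσ.2⟩, Fin.append_left, Fin.append_right]
  have hcl : σs ∈ closure (Ioo 0 σs) := by
    rw [closure_Ioo hσpos.ne]; exact ⟨hσpos.le, le_rfl⟩
  have hEq : IsClosed {σ | f σ = g σ} := isClosed_eq hfc hgc
  have hsub : Ioo 0 σs ⊆ {σ | f σ = g σ} := fun σ hσ => hfg σ hσ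
  have hσfg : f σs = g σs := (hEq.closure_subset_iff.2 hsub) hcl
  -- contradiction: `f σs = ε`, `g σs > ε`
  have h1 : f σs = ε := hdist
  have h2 : ε < g σs := hsep σs ⟨hσI.1, hσI.2⟩ i j
  linarith

end DecouplingLemma

/-! ## §4. The transported datum and the pointwise comparison -/

section Pointwise

variable {ε : ℝ} (hε : 0 < ε) (hε' : ε < 2⁻¹) {s m : ℕ}

/-- The collision window of duration `h` of a tagged configuration `Xs`: the untagged data with
some tagged–untagged pair at minimal-image distance in `[ε, ε + 2h√(2E(Xs, Z))]` — the set of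
`lintegral_window_le` (`HardSphereBBGKYLiouvilleWindow`), outside of which no tagged–untagged
pair can touch within time `h`. [cite: CIP1994, App. 4.B] -/
def collisionWindowSet (ε : ℝ) (Xs : Config s d (UnitAddTorus d)) (h : ℝ) : Set (Config m d (UnitAddTorus d)) :=
  {Zm | ∃ (i : Fin s) (j : Fin m), ε ≤ Torus.euclidDist (Xs i).1 (Zm j).1 ∧
    Torus.euclidDist (Xs i).1 (Zm j).1 ≤ ε + 2 * h * Real.sqrt (2 * configEnergy (Fin.append Xs Zm))}

omit [Fintype d] in
/-- Membership in the collision window. [folklore] -/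
theorem mem_collisionWindowSet [Fintype d] {Xs : Config s d (UnitAddTorus d)} {h : ℝ} {Zm : Config m d (UnitAddTorus d)} :
    Zm ∈ collisionWindowSet (m := m) ε Xs h ↔ ∃ (i : Fin s) (j : Fin m), ε ≤ Torus.euclidDist (Xs i).1 (Zm j).1 ∧
      Torus.euclidDist (Xs i).1 (Zm j).1 ≤ ε + 2 * h * Real.sqrt (2 * configEnergy (Fin.append Xs Zm)) :=
  Iff.rfl

/-- The collision window is measurable (`measurableSet_window`). [folklore] -/
theorem measurableSet_collisionWindowSet (Xs : Config s d (UnitAddTorus d)) (h : ℝ) :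
    MeasurableSet (collisionWindowSet (m := m) ε Xs h) :=
  measurableSet_window Xs h

/-- **The transported datum** along the regularised `(s+m)`-sphere flow, restricted to the good
set: `F_t(z) = 1_{good}(z) F₀(Φ^{s+m}_{-t} z)` (the integrand of the honest marginals
`transportedMarginal` / `bgsrMarginalFamily`). [folklore] -/
def transportedDatum (F₀ : Config (s + m) d (UnitAddTorus d) → ℝ) (t : ℝ) (z : Config (s + m) d (UnitAddTorus d)) : ℝ :=
  (Alexander.good (N := s + m) (Torus.geometry d) ε).indicator
    (fun z => F₀ (Alexander.regFlow (Torus.geometry d) ε (-t) z)) z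

variable (F₀ : Config (s + m) d (UnitAddTorus d) → ℝ)

include hε hε' in
/-- **The transported datum is transported by the flow, everywhere**: `F_{τ-u}(z) = F_τ(Φ_u z)`
for every `z` (group law of the regularised flow on the whole phase space, invariance of the good
set; off the good set both sides vanish). [folklore] -/
theorem transportedDatum_sub_eq (τ u : ℝ) (z : Config (s + m) d (UnitAddTorus d)) :
    transportedDatum (ε := ε) F₀ (τ - u) z =
      transportedDatum (ε := ε) F₀ τ (Alexander.regFlow (Torus.geometry d) ε u z) := by
  unfold transportedDatum
  by_cases hz : z ∈ Alexander.good (N := s + m) (Torus.geometry d) ε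
  · have hz' : Alexander.regFlow (Torus.geometry d) ε u z ∈ Alexander.good (N := s + m) (Torus.geometry d) ε :=
      Alexander.mapsTo_regFlow_good hε hε' u hz
    rw [indicator_of_mem hz, indicator_of_mem hz', ← Alexander.regFlow_add hε hε',
      show -τ + u = -(τ - u) by ring]
  · have hz' : Alexander.regFlow (Torus.geometry d) ε u z ∉ Alexander.good (N := s + m) (Torus.geometry d) ε := by
      rwa [Alexander.regFlow_of_not_mem hz]
    rw [indicator_of_notMem hz, indicator_of_notMem hz']

/-- The transported datum inherits the Gaussian bound of the datum (energy conservation).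
[folklore] -/
theorem abs_transportedDatum_le {C b : ℝ} (hC : 0 ≤ C) (hF₀ : ∀ z, |F₀ z| ≤ C * Real.exp (-b * configEnergy z))
    (t : ℝ) (z : Config (s + m) d (UnitAddTorus d)) :
    |transportedDatum (ε := ε) F₀ t z| ≤ C * Real.exp (-b * configEnergy z) := by
  unfold transportedDatum
  by_cases hz : z ∈ Alexander.good (N := s + m) (Torus.geometry d) ε
  · rw [indicator_of_mem hz]
    have h := hF₀ (Alexander.regFlow (Torus.geometry d) ε (-t) z)
    rwa [Alexander.configEnergy_regFlow] at h
  · rw [indicator_of_notMem hz, abs_zero]; positivity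

/-- A nonzero value of the transported datum is taken on the good set. [folklore] -/
theorem mem_good_of_transportedDatum_ne_zero {t : ℝ} {z : Config (s + m) d (UnitAddTorus d)}
    (h : transportedDatum (ε := ε) F₀ t z ≠ 0) : z ∈ Alexander.good (N := s + m) (Torus.geometry d) ε := by
  by_contra hz
  exact h (indicator_of_notMem hz _)

include hε hε' in
/-- The transported datum is measurable (measurable datum). [folklore] -/
theorem measurable_transportedDatum (hF₀m : Measurable F₀) (t : ℝ) :
    Measurable (transportedDatum (ε := ε) F₀ t) := by
  unfold transportedDatum
  exact (hF₀m.comp (Alexander.measurable_regFlow hε' (-t))).indicator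
    (Alexander.regHardSphereFlow (d := d) hε hε' (s + m)).measurableSet_good

include hε hε' in
/-- **Pointwise comparison of the two integrands.** For `u ≥ 0`, a good tagged `W` and an
untagged `Z` with `Z ∈ D^m ⇒ Z good` and `(Φ^s_{-u}W, Z) ∈ D^{s+m} ⇒ good`, the integrands
`A = F_τ(Φ^{s+m}_u(Φ^s_{-u} W, Z))` and `B = F_τ(W, Φ^m_u Z)` satisfy
`|A - B| ≤ |A| 1[Z ∈ window(Φ^s_{-u}W, u)] + |B| 1[Φ^m_u Z ∈ window(W, u)]`: whenever a read is
nonzero and its configuration is outside the collision window, the tagged–untagged distances of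
the decoupled evolution stay `> ε` on `[0, u]` (`abs_decoupledDist_sub_le`), so the
`(s+m)`-orbit is decoupled (`HardSphereFlow.flow_append_eq_of_decoupled`) and `A = B`.
[cite: CIP1994, App. 4.B] -/
theorem abs_sub_le_indicator_collisionWindowSet (τ : ℝ) {u : ℝ} (hu : 0 ≤ u)
    {W : Config s d (UnitAddTorus d)} (hW : W ∈ Alexander.good (N := s) (Torus.geometry d) ε)
    {Zm : Config m d (UnitAddTorus d)}
    (hZ : Zm ∈ hardSphereDomain (Torus.geometry d) m ε → Zm ∈ Alexander.good (N := m) (Torus.geometry d) ε)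
    (hfib : Fin.append (Alexander.regFlow (Torus.geometry d) ε (-u) W) Zm ∈ hardSphereDomain (Torus.geometry d) (s + m) ε →
      Fin.append (Alexander.regFlow (Torus.geometry d) ε (-u) W) Zm ∈ Alexander.good (N := s + m) (Torus.geometry d) ε) :
    |transportedDatum (ε := ε) F₀ τ (Alexander.regFlow (Torus.geometry d) ε u
          (Fin.append (Alexander.regFlow (Torus.geometry d) ε (-u) W) Zm)) -
        transportedDatum (ε := ε) F₀ τ (Fin.append W (Alexander.regFlow (Torus.geometry d) ε u Zm))| ≤
      |transportedDatum (ε := ε) F₀ τ (Alexander.regFlow (Torus.geometry d) ε u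
          (Fin.append (Alexander.regFlow (Torus.geometry d) ε (-u) W) Zm))| *
          (collisionWindowSet (m := m) ε (Alexander.regFlow (Torus.geometry d) ε (-u) W) u).indicator 1 Zm +
        |transportedDatum (ε := ε) F₀ τ (Fin.append W (Alexander.regFlow (Torus.geometry d) ε u Zm))| *
          (collisionWindowSet (m := m) ε W u).indicator 1 (Alexander.regFlow (Torus.geometry d) ε u Zm) := by
  set G := Torus.geometry d with hGdef
  set Φs := Alexander.regHardSphereFlow (d := d) hε hε' s with hΦs
  set Φm := Alexander.regHardSphereFlow (d := d) hε hε' m with hΦm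
  set Φn := Alexander.regHardSphereFlow (d := d) hε hε' (s + m) with hΦn
  set wu := Alexander.regFlow (Torus.geometry d) ε (-u) W with hwu
  set y : Config (s + m) d (UnitAddTorus d) := Fin.append wu Zm with hy
  set z : Config (s + m) d (UnitAddTorus d) := Fin.append W (Alexander.regFlow (Torus.geometry d) ε u Zm) with hz
  set A := transportedDatum (ε := ε) F₀ τ (Alexander.regFlow (Torus.geometry d) ε u y) with hA
  set B := transportedDatum (ε := ε) F₀ τ z with hB
  have hwu_good : wu ∈ Alexander.good (N := s) (Torus.geometry d) ε := Alexander.mapsTo_regFlow_good hε hε' (-u) hW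
  have hWback : Alexander.regFlow (Torus.geometry d) ε u wu = W := by
    rw [hwu, ← Alexander.regFlow_add hε hε', add_neg_cancel, Alexander.regFlow_zero hε hε']
  -- energies
  have hEy : configEnergy y = configEnergy W + configEnergy Zm := by
    rw [hy, configEnergy_append, hwu, Alexander.configEnergy_regFlow]
  have hEz : configEnergy z = configEnergy W + configEnergy Zm := by
    rw [hz, configEnergy_append, Alexander.configEnergy_regFlow]
  set V : ℝ := Real.sqrt (2 * (configEnergy W + configEnergy Zm)) with hV
  have hV0 : 0 ≤ V := Real.sqrt_nonneg _
  -- the decoupled end configuration is `z`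
  have hend : Fin.append (Φs.flow u wu) (Φm.flow u Zm) = z := by
    show Fin.append (Alexander.regFlow (Torus.geometry d) ε u wu) (Alexander.regFlow (Torus.geometry d) ε u Zm) = z
    rw [hWback]
  -- the decoupling lemma under the distance hypothesis
  have key : Zm ∈ Alexander.good (N := m) (Torus.geometry d) ε → y ∈ Alexander.good (N := s + m) (Torus.geometry d) ε →
      (∀ σ ∈ Icc 0 u, ∀ (I : Fin s) (j : Fin m), ε < Torus.euclidDist (Φs.flow σ wu I).1 (Φm.flow σ Zm j).1) →
      Alexander.regFlow (Torus.geometry d) ε u y = z := by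
    intro hZg hyg hsep
    have h := HardSphereFlow.flow_append_eq_of_decoupled Φs Φm Φn (w := wu) (Zm := Zm) hyg hwu_good hZg hu hsep u
      ⟨hu, le_rfl⟩
    rw [hend] at h
    exact h
  -- Lipschitz bound of the decoupled cross distances
  have hlip : Zm ∈ Alexander.good (N := m) (Torus.geometry d) ε → ∀ (I : Fin s) (j : Fin m) (σ σ' : ℝ),
      |Torus.euclidDist (Φs.flow σ wu I).1 (Φm.flow σ Zm j).1 - Torus.euclidDist (Φs.flow σ' wu I).1 (Φm.flow σ' Zm j).1| ≤
        2 * V * |σ - σ'| := by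
    intro hZg I j σ σ'
    have h := abs_decoupledDist_sub_le Φs Φm hwu_good hZg I j σ σ'
    have hE : configEnergy (Fin.append wu Zm) = configEnergy W + configEnergy Zm := hEy
    rwa [hE] at h
  -- (α') reads of `A`
  have hα : A ≠ 0 → Zm ∉ collisionWindowSet (m := m) ε wu u → A = B := by
    intro hA0 hwin
    have hyu : Alexander.regFlow (Torus.geometry d) ε u y ∈ Alexander.good (N := s + m) (Torus.geometry d) ε :=
      mem_good_of_transportedDatum_ne_zero F₀ hA0
    have hyg : y ∈ Alexander.good (N := s + m) (Torus.geometry d) ε := by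
      by_contra hyb
      rw [Alexander.regFlow_of_not_mem hyb] at hyu
      exact hyb hyu
    have hyD : y ∈ hardSphereDomain (Torus.geometry d) (s + m) ε := Alexander.good_subset_hardSphereDomain hyg
    have hZD : Zm ∈ hardSphereDomain (Torus.geometry d) m ε := by
      have h := comp_natAdd_mem_hardSphereDomain (s := s) (m := m) hyD
      have hyZ : (y ∘ Fin.natAdd s : Config m d (UnitAddTorus d)) = Zm := funext fun j => Fin.append_right wu Zm j
      rwa [hyZ] at h
    have hZg := hZ hZD
    -- cross distances at time `0` exceed the window
    have h0 : ∀ (I : Fin s) (j : Fin m), ε + 2 * u * V < Torus.euclidDist (wu I).1 (Zm j).1 := by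
      intro I j
      have hge : ε ≤ Torus.euclidDist (wu I).1 (Zm j).1 := by
        have h := (mem_hardSphereDomain.1 hyD) (Fin.castAdd m I) (Fin.natAdd s j) (fun h => by
          have := congrArg Fin.val h; simp at this; omega)
        rwa [Torus.norm_geometry_sepVec, hy, Fin.append_left, Fin.append_right] at h
      by_contra hle
      push Not at hle
      apply hwin
      refine ⟨I, j, hge, ?_⟩
      have hE : configEnergy (Fin.append wu Zm) = configEnergy W + configEnergy Zm := hEy
      rw [hE]
      exact hle
    have hk := key hZg hyg fun σ hσ I j => ?_
    · rw [hA, hk]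
    have hl := hlip hZg I j σ 0
    rw [sub_zero, abs_of_nonneg hσ.1] at hl
    have hstart : Torus.euclidDist (Φs.flow 0 wu I).1 (Φm.flow 0 Zm j).1 = Torus.euclidDist (wu I).1 (Zm j).1 := by
      show Torus.euclidDist (Alexander.regFlow (Torus.geometry d) ε 0 wu I).1 (Alexander.regFlow (Torus.geometry d) ε 0 Zm j).1 = _
      rw [Alexander.regFlow_zero hε hε', Alexander.regFlow_zero hε hε']
    rw [hstart] at hl
    have h1 := h0 I j
    rw [abs_le] at hl
    nlinarith [hl.1, hσ.2, hV0, mul_nonneg hV0 hσ.1]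
  -- (β') reads of `B`
  have hβ : B ≠ 0 → Alexander.regFlow (Torus.geometry d) ε u Zm ∉ collisionWindowSet (m := m) ε W u → A = B := by
    intro hB0 hwin
    have hzg : z ∈ Alexander.good (N := s + m) (Torus.geometry d) ε := mem_good_of_transportedDatum_ne_zero F₀ hB0
    have hzD : z ∈ hardSphereDomain (Torus.geometry d) (s + m) ε := Alexander.good_subset_hardSphereDomain hzg
    -- `Z ∈ D^m`: otherwise `Φ^m_u Z = Z` and `z ∉ D`
    have hZD : Zm ∈ hardSphereDomain (Torus.geometry d) m ε := by
      by_contra hZD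
      have hfix : Alexander.regFlow (Torus.geometry d) ε u Zm = Zm :=
        Alexander.regFlow_of_not_mem (fun h => hZD (Alexander.good_subset_hardSphereDomain h)) u
      have h := comp_natAdd_mem_hardSphereDomain (s := s) (m := m) hzD
      have hzZ : (z ∘ Fin.natAdd s : Config m d (UnitAddTorus d)) = Zm := by
        funext j; rw [Function.comp_apply, hz, Fin.append_right, hfix]
      rw [hzZ] at h
      exact hZD h
    have hZg := hZ hZD
    -- cross distances of `z` exceed the window
    have hu0 : ∀ (I : Fin s) (j : Fin m), ε + 2 * u * V <
        Torus.euclidDist (W I).1 (Alexander.regFlow (Torus.geometry d) ε u Zm j).1 := by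
      intro I j
      have hge : ε ≤ Torus.euclidDist (W I).1 (Alexander.regFlow (Torus.geometry d) ε u Zm j).1 := by
        have h := (mem_hardSphereDomain.1 hzD) (Fin.castAdd m I) (Fin.natAdd s j) (fun h => by
          have := congrArg Fin.val h; simp at this; omega)
        rwa [Torus.norm_geometry_sepVec, hz, Fin.append_left, Fin.append_right] at h
      by_contra hle
      push Not at hle
      apply hwin
      refine ⟨I, j, hge, ?_⟩
      rw [hEz]
      exact hle
    -- the decoupled cross distances stay `> ε` on `[0, u]` (Lipschitz bound backward from `u`)
    have hsep : ∀ σ ∈ Icc 0 u, ∀ (I : Fin s) (j : Fin m), ε < Torus.euclidDist (Φs.flow σ wu I).1 (Φm.flow σ Zm j).1 := by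
      intro σ hσ I j
      have hl := hlip hZg I j σ u
      have hendIJ : Torus.euclidDist (Φs.flow u wu I).1 (Φm.flow u Zm j).1 =
          Torus.euclidDist (W I).1 (Alexander.regFlow (Torus.geometry d) ε u Zm j).1 := by
        show Torus.euclidDist (Alexander.regFlow (Torus.geometry d) ε u wu I).1 (Alexander.regFlow (Torus.geometry d) ε u Zm j).1 = _
        rw [hWback]
      rw [hendIJ, show |σ - u| = u - σ by rw [abs_sub_comm]; exact abs_of_nonneg (sub_nonneg.2 hσ.2)] at hl
      have h1 := hu0 I j
      rw [abs_le] at hl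
      nlinarith [hl.1, hσ.1, hσ.2, hV0, mul_nonneg hV0 (sub_nonneg.2 hσ.2)]
    -- `y ∈ D^{s+m}`, hence good by the fibre hypothesis
    have hyD : y ∈ hardSphereDomain (Torus.geometry d) (s + m) ε := by
      rw [mem_hardSphereDomain]
      intro I J hIJ
      rcases eq_castAdd_or_eq_natAdd I with ⟨i, rfl⟩ | ⟨i, rfl⟩
      · rcases eq_castAdd_or_eq_natAdd J with ⟨j, rfl⟩ | ⟨j, rfl⟩
        · have hij : i ≠ j := fun h => hIJ (h ▸ rfl)
          have h := (mem_hardSphereDomain.1 (Alexander.good_subset_hardSphereDomain hwu_good)) i j hij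
          rwa [hy, Fin.append_left, Fin.append_left]
        · rw [hy, Fin.append_left, Fin.append_right, Torus.norm_geometry_sepVec]
          have h := hsep 0 ⟨le_rfl, hu⟩ i j
          have h0 : Torus.euclidDist (Φs.flow 0 wu i).1 (Φm.flow 0 Zm j).1 = Torus.euclidDist (wu i).1 (Zm j).1 := by
            show Torus.euclidDist (Alexander.regFlow (Torus.geometry d) ε 0 wu i).1 (Alexander.regFlow (Torus.geometry d) ε 0 Zm j).1 = _
            rw [Alexander.regFlow_zero hε hε', Alexander.regFlow_zero hε hε']
          rw [h0] at h
          exact h.le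
      · rcases eq_castAdd_or_eq_natAdd J with ⟨j, rfl⟩ | ⟨j, rfl⟩
        · rw [hy, Fin.append_right, Fin.append_left, Torus.norm_geometry_sepVec, Torus.euclidDist_comm]
          have h := hsep 0 ⟨le_rfl, hu⟩ j i
          have h0 : Torus.euclidDist (Φs.flow 0 wu j).1 (Φm.flow 0 Zm i).1 = Torus.euclidDist (wu j).1 (Zm i).1 := by
            show Torus.euclidDist (Alexander.regFlow (Torus.geometry d) ε 0 wu j).1 (Alexander.regFlow (Torus.geometry d) ε 0 Zm i).1 = _
            rw [Alexander.regFlow_zero hε hε', Alexander.regFlow_zero hε hε']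
          rw [h0] at h
          exact h.le
        · have hij : i ≠ j := fun h => hIJ (h ▸ rfl)
          have h := (mem_hardSphereDomain.1 hZD) i j hij
          rwa [hy, Fin.append_right, Fin.append_right]
    have hk := key hZg (hfib hyD) hsep
    rw [hA, hk]
  -- conclusion by cases
  by_cases heq : A = B
  · rw [heq, sub_self, abs_zero]
    exact add_nonneg (mul_nonneg (abs_nonneg _) (indicator_nonneg (fun _ _ => zero_le_one) _))
      (mul_nonneg (abs_nonneg _) (indicator_nonneg (fun _ _ => zero_le_one) _))
  · have h1 : |A| ≤ |A| * (collisionWindowSet (m := m) ε wu u).indicator 1 Zm := by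
      by_cases hA0 : A = 0
      · rw [hA0, abs_zero, zero_mul]
      · have hmem : Zm ∈ collisionWindowSet (m := m) ε wu u := by
          by_contra hn; exact heq (hα hA0 hn)
        rw [indicator_of_mem hmem, Pi.one_apply, mul_one]
    have h2 : |B| ≤ |B| * (collisionWindowSet (m := m) ε W u).indicator 1 (Alexander.regFlow (Torus.geometry d) ε u Zm) := by
      by_cases hB0 : B = 0
      · rw [hB0, abs_zero, zero_mul]
      · have hmem : Alexander.regFlow (Torus.geometry d) ε u Zm ∈ collisionWindowSet (m := m) ε W u := by
          by_contra hn; exact heq (hβ hB0 hn)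
        rw [indicator_of_mem hmem, Pi.one_apply, mul_one]
    calc |A - B| ≤ |A| + |B| := abs_sub _ _
      _ ≤ _ := add_le_add h1 h2

end Pointwise

/-! ## §5. The short-time decoupling estimate for the tagged marginal -/

section Estimate

variable {ε : ℝ} (hε : 0 < ε) (hε' : ε < 2⁻¹) {s m : ℕ} (F₀ : Config (s + m) d (UnitAddTorus d) → ℝ)

/-- Juxtaposition with a fixed tagged configuration is measurable in the untagged one. [folklore] -/
theorem measurable_append_right (W : Config s d (UnitAddTorus d)) :
    Measurable fun Zm : Config m d (UnitAddTorus d) => (Fin.append W Zm : Config (s + m) d (UnitAddTorus d)) := by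
  haveI : SigmaFinite (volume : Measure (UnitAddTorus d × EuclideanSpace ℝ d)) := inferInstance
  obtain ⟨e, he, -⟩ := exists_appendEquiv s m (UnitAddTorus d × EuclideanSpace ℝ d)
  have h : (fun Zm : Config m d (UnitAddTorus d) => (Fin.append W Zm : Config (s + m) d (UnitAddTorus d))) =
      fun Zm => e (W, Zm) := funext fun Zm => (he (W, Zm)).symm
  rw [h]
  exact e.measurable.comp (measurable_const.prodMk measurable_id)

/-- A set-restricted Gaussian integral is at most a given bound when its `lintegral` is.
[folklore] -/
theorem integral_indicator_le_of_lintegral_le {S : Set (Config m d (UnitAddTorus d))} (hS : MeasurableSet S)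
    {g : Config m d (UnitAddTorus d) → ℝ} (hg0 : ∀ Z, 0 ≤ g Z) (hgm : Measurable g) {b : ℝ} (hb : 0 ≤ b)
    (h : ∫⁻ Z in S, ENNReal.ofReal (g Z) ≤ ENNReal.ofReal b) :
    ∫ Z, S.indicator g Z ≤ b := by
  rw [integral_indicator hS, integral_eq_lintegral_of_nonneg_ae (Eventually.of_forall fun Z => hg0 Z)
    hgm.aestronglyMeasurable.restrict]
  exact ENNReal.toReal_le_of_le_ofReal hb h

include hε hε' in
/-- **The short-time decoupling estimate (the trace of the marginal along the backward tagged
flow).** For `s + m` hard spheres on `T^d` (`0 < ε < 1/2`), a measurable datum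
`|F₀| ≤ C e^{-βE}` (`β > 0`) transported along the regularised `(s+m)`-flow
(`transportedDatum`) and its tagged marginal `f(t, W) = ∫ F_t(W, Z) dZ`, there is `A ≥ 0`
(the window constant of `lintegral_window_le`) such that for every `τ`, every `u ≥ 0` and every
good `W` whose backward image `Φ^s_{-u} W` has a good fibre (for a.e. untagged `Z`, the
juxtaposition is good whenever it lies in the domain),
`|f(τ - u, Φ^s_{-u} W) - f(τ, W)| ≤ 2 C A u e^{-(β/2) E(W)}`. Proof: `F_{τ-u} = F_τ ∘ Φ^{s+m}_u`
(`transportedDatum_sub_eq`) and `dZ` is `Φ^m_u`-invariant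
(`Alexander.measurePreserving_regFlow_volume`), so the difference is
`∫ [F_τ(Φ^{s+m}_u(Φ^s_{-u}W, Z)) - F_τ(W, Φ^m_u Z)] dZ`, whose integrand is controlled by the
two collision-window indicators (`abs_sub_le_indicator_collisionWindowSet`), each of Gaussian
volume `≤ u A e^{-(β/2)E}` (`lintegral_window_le`). (CIP 1994 App. 4.B: the contribution of a
tagged–untagged collision in a time `u` is `O(u)`.) [cite: CIP1994, §4.3 and App. 4.B] -/
theorem abs_marginal_backward_sub_le {β C : ℝ} (hβ : 0 < β) (hC : 0 ≤ C) (hF₀m : Measurable F₀)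
    (hF₀ : ∀ z, |F₀ z| ≤ C * Real.exp (-β * configEnergy z)) :
    ∃ A : ℝ, 0 ≤ A ∧ ∀ (τ : ℝ) {u : ℝ}, 0 ≤ u → ∀ {W : Config s d (UnitAddTorus d)},
      W ∈ Alexander.good (N := s) (Torus.geometry d) ε →
      (∀ᵐ Zm : Config m d (UnitAddTorus d),
        Fin.append (Alexander.regFlow (Torus.geometry d) ε (-u) W) Zm ∈ hardSphereDomain (Torus.geometry d) (s + m) ε →
        Fin.append (Alexander.regFlow (Torus.geometry d) ε (-u) W) Zm ∈ Alexander.good (N := s + m) (Torus.geometry d) ε) →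
      |(∫ Zm : Config m d (UnitAddTorus d),
          transportedDatum (ε := ε) F₀ (τ - u) (Fin.append (Alexander.regFlow (Torus.geometry d) ε (-u) W) Zm)) -
        ∫ Zm : Config m d (UnitAddTorus d), transportedDatum (ε := ε) F₀ τ (Fin.append W Zm)| ≤
        2 * C * A * u * Real.exp (-(β / 2) * configEnergy W) := by
  haveI : SigmaFinite (volume : Measure (UnitAddTorus d × EuclideanSpace ℝ d)) := inferInstance
  have hε2 : ε ≤ 1 / 2 := by rw [one_div]; exact hε'.le
  obtain ⟨A, hA0, hwin⟩ := lintegral_window_le (d := d) hε hε2 hβ s m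
  refine ⟨A, hA0, fun τ u hu W hW hfib => ?_⟩
  set wu := Alexander.regFlow (Torus.geometry d) ε (-u) W with hwu
  have hEwu : configEnergy wu = configEnergy W := by rw [hwu, Alexander.configEnergy_regFlow]
  -- the two integrands after the rewriting
  set fA : Config m d (UnitAddTorus d) → ℝ := fun Zm =>
    transportedDatum (ε := ε) F₀ τ (Alexander.regFlow (Torus.geometry d) ε u (Fin.append wu Zm)) with hfA
  set fB : Config m d (UnitAddTorus d) → ℝ := fun Zm =>
    transportedDatum (ε := ε) F₀ τ (Fin.append W (Alexander.regFlow (Torus.geometry d) ε u Zm)) with hfB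
  set f2 : Config m d (UnitAddTorus d) → ℝ := fun Zm => transportedDatum (ε := ε) F₀ τ (Fin.append W Zm) with hf2
  -- the two bounding functions
  set g₁ : Config m d (UnitAddTorus d) → ℝ := fun Zm => Real.exp (-β * configEnergy (Fin.append wu Zm)) with hg₁
  set g₂ : Config m d (UnitAddTorus d) → ℝ := fun Zm => Real.exp (-β * configEnergy (Fin.append W Zm)) with hg₂
  set S₁ : Set (Config m d (UnitAddTorus d)) := collisionWindowSet (m := m) ε wu u with hS₁
  set S₂ : Set (Config m d (UnitAddTorus d)) := collisionWindowSet (m := m) ε W u with hS₂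
  have hS₁m : MeasurableSet S₁ := measurableSet_collisionWindowSet wu u
  have hS₂m : MeasurableSet S₂ := measurableSet_collisionWindowSet W u
  -- measurability
  have hTm : Measurable (transportedDatum (ε := ε) (s := s) (m := m) F₀ τ) := measurable_transportedDatum hε hε' F₀ hF₀m τ
  have hflm : Measurable (Alexander.regFlow (N := m) (Torus.geometry d) ε u) := Alexander.measurable_regFlow hε' u
  have hfln : Measurable (Alexander.regFlow (N := s + m) (Torus.geometry d) ε u) := Alexander.measurable_regFlow hε' u
  have hfAm : Measurable fA := hTm.comp (hfln.comp (measurable_append_right wu))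
  have hf2m : Measurable f2 := hTm.comp (measurable_append_right W)
  have hfBm : Measurable fB := hf2m.comp hflm
  have hg₁m : Measurable g₁ := by
    have h := (Literature.Analysis.FluidPDE.Alexander.measurable_configEnergy (N := s + m)).comp (measurable_append_right (m := m) wu)
    exact (measurable_const.mul h).exp
  have hg₂m : Measurable g₂ := by
    have h := (Literature.Analysis.FluidPDE.Alexander.measurable_configEnergy (N := s + m)).comp (measurable_append_right (m := m) W)
    exact (measurable_const.mul h).exp
  -- Gaussian integrability of the bounds
  have hGi : Integrable (fun Zm : Config m d (UnitAddTorus d) => Real.exp (-β * configEnergy Zm)) :=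
    integrable_exp_neg_mul_configEnergy hβ
  have hg₁_eq : ∀ Zm, g₁ Zm = Real.exp (-β * configEnergy W) * Real.exp (-β * configEnergy Zm) := by
    intro Zm
    rw [hg₁]; simp only
    rw [configEnergy_append, hEwu, mul_add, Real.exp_add]
  have hg₂_eq : ∀ Zm, g₂ Zm = Real.exp (-β * configEnergy W) * Real.exp (-β * configEnergy Zm) := by
    intro Zm
    rw [hg₂]; simp only
    rw [configEnergy_append, mul_add, Real.exp_add]
  have hg₁i : Integrable g₁ := by
    have : g₁ = fun Zm => Real.exp (-β * configEnergy W) * Real.exp (-β * configEnergy Zm) := funext hg₁_eq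
    rw [this]; exact hGi.const_mul _
  have hg₂i : Integrable g₂ := by
    have : g₂ = fun Zm => Real.exp (-β * configEnergy W) * Real.exp (-β * configEnergy Zm) := funext hg₂_eq
    rw [this]; exact hGi.const_mul _
  -- pointwise bounds of the integrands
  have hfA_le : ∀ Zm, |fA Zm| ≤ C * g₁ Zm := by
    intro Zm
    have h := abs_transportedDatum_le (ε := ε) F₀ hC hF₀ τ (Alexander.regFlow (Torus.geometry d) ε u (Fin.append wu Zm))
    rwa [Alexander.configEnergy_regFlow] at h
  have hfB_le : ∀ Zm, |fB Zm| ≤ C * g₂ (Alexander.regFlow (Torus.geometry d) ε u Zm) := by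
    intro Zm
    have h := abs_transportedDatum_le (ε := ε) F₀ hC hF₀ τ (Fin.append W (Alexander.regFlow (Torus.geometry d) ε u Zm))
    exact h
  have hf2_le : ∀ Zm, |f2 Zm| ≤ C * g₂ Zm := fun Zm =>
    abs_transportedDatum_le (ε := ε) F₀ hC hF₀ τ (Fin.append W Zm)
  have hg₂fl : ∀ Zm, g₂ (Alexander.regFlow (Torus.geometry d) ε u Zm) =
      Real.exp (-β * configEnergy W) * Real.exp (-β * configEnergy Zm) := by
    intro Zm; rw [hg₂_eq, Alexander.configEnergy_regFlow]
  have hfAi : Integrable fA :=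
    (hg₁i.const_mul C).mono' hfAm.aestronglyMeasurable (Eventually.of_forall hfA_le)
  have hfBi : Integrable fB := by
    have hi : Integrable (fun Zm => C * g₂ (Alexander.regFlow (Torus.geometry d) ε u Zm)) := by
      have : (fun Zm => C * g₂ (Alexander.regFlow (Torus.geometry d) ε u Zm)) =
          fun Zm => (C * Real.exp (-β * configEnergy W)) * Real.exp (-β * configEnergy Zm) := by
        funext Zm; rw [hg₂fl]; ring
      rw [this]; exact hGi.const_mul _
    exact hi.mono' hfBm.aestronglyMeasurable (Eventually.of_forall hfB_le)
  have hf2i : Integrable f2 :=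
    (hg₂i.const_mul C).mono' hf2m.aestronglyMeasurable (Eventually.of_forall hf2_le)
  -- the measure-preserving untagged flow
  have hmp := Alexander.measurePreserving_regFlow_volume (d := d) (N := m) hε hε' u
  have hcv : ∀ (g : Config m d (UnitAddTorus d) → ℝ), Measurable g →
      ∫ Zm, g (Alexander.regFlow (Torus.geometry d) ε u Zm) = ∫ Zm, g Zm := by
    intro g hg
    calc ∫ Zm, g (Alexander.regFlow (Torus.geometry d) ε u Zm)
        = ∫ Zm, g Zm ∂(Measure.map (Alexander.regFlow (N := m) (Torus.geometry d) ε u) volume) :=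
          (integral_map hmp.aemeasurable hg.aestronglyMeasurable).symm
      _ = ∫ Zm, g Zm := by rw [hmp.map_eq]
  -- rewriting of the two marginals
  have h1 : ∫ Zm, transportedDatum (ε := ε) F₀ (τ - u) (Fin.append wu Zm) = ∫ Zm, fA Zm :=
    integral_congr_ae (Eventually.of_forall fun Zm => transportedDatum_sub_eq hε hε' F₀ τ u _)
  have h2 : ∫ Zm, f2 Zm = ∫ Zm, fB Zm := (hcv f2 hf2m).symm
  -- the a.e. pointwise comparison
  have hgoodm : ∀ᵐ Zm : Config m d (UnitAddTorus d), Zm ∈ hardSphereDomain (Torus.geometry d) m ε →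
      Zm ∈ Alexander.good (N := m) (Torus.geometry d) ε := by
    have h := (Alexander.regHardSphereFlow (d := d) hε hε' m).measure_compl_good
    rw [liouville_eq, Measure.restrict_apply (Alexander.regHardSphereFlow (d := d) hε hε' m).measurableSet_good.compl,
      Set.inter_comm] at h
    filter_upwards [measure_eq_zero_iff_ae_notMem.1 h] with Zm hZm hD
    by_contra hg
    exact hZm ⟨hD, hg⟩
  have hpt : ∀ᵐ Zm : Config m d (UnitAddTorus d), |fA Zm - fB Zm| ≤
      C * S₁.indicator g₁ Zm + C * S₂.indicator g₂ (Alexander.regFlow (Torus.geometry d) ε u Zm) := by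
    filter_upwards [hgoodm, hfib] with Zm hZ hfibZ
    have h := abs_sub_le_indicator_collisionWindowSet hε hε' F₀ τ hu hW hZ hfibZ
    refine h.trans (add_le_add ?_ ?_)
    · by_cases hmem : Zm ∈ S₁
      · rw [indicator_of_mem hmem, indicator_of_mem hmem, Pi.one_apply, mul_one]
        exact hfA_le Zm
      · rw [indicator_of_notMem hmem, indicator_of_notMem hmem, mul_zero, mul_zero]
    · by_cases hmem : Alexander.regFlow (Torus.geometry d) ε u Zm ∈ S₂
      · rw [indicator_of_mem hmem, indicator_of_mem hmem, Pi.one_apply, mul_one]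
        exact hfB_le Zm
      · rw [indicator_of_notMem hmem, indicator_of_notMem hmem, mul_zero, mul_zero]
  -- the two window integrals
  have hI₁ : ∫ Zm, S₁.indicator g₁ Zm ≤ u * A * Real.exp (-(β / 2) * configEnergy W) := by
    refine integral_indicator_le_of_lintegral_le hS₁m (fun Z => (Real.exp_pos _).le) hg₁m (by positivity) ?_
    have h := hwin u hu wu
    rw [hEwu] at h
    exact h
  have hI₂ : ∫ Zm, S₂.indicator g₂ (Alexander.regFlow (Torus.geometry d) ε u Zm) ≤ u * A * Real.exp (-(β / 2) * configEnergy W) := by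
    rw [hcv (S₂.indicator g₂) (hg₂m.indicator hS₂m)]
    exact integral_indicator_le_of_lintegral_le hS₂m (fun Z => (Real.exp_pos _).le) hg₂m (by positivity) (hwin u hu W)
  have hind₁i : Integrable (S₁.indicator g₁) := hg₁i.indicator hS₁m
  have hind₂i : Integrable (fun Zm => S₂.indicator g₂ (Alexander.regFlow (Torus.geometry d) ε u Zm)) := by
    have hi := hg₂i.indicator hS₂m
    exact (hmp.integrable_comp (hg₂m.indicator hS₂m).aestronglyMeasurable).2 hi
  -- assembly
  rw [h1, h2, ← integral_sub hfAi hfBi]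
  calc |∫ Zm, fA Zm - fB Zm| ≤ ∫ Zm, |fA Zm - fB Zm| := abs_integral_le_integral_abs
    _ ≤ ∫ Zm, (C * S₁.indicator g₁ Zm + C * S₂.indicator g₂ (Alexander.regFlow (Torus.geometry d) ε u Zm)) :=
        integral_mono_ae (hfAi.sub hfBi).abs ((hind₁i.const_mul C).add (hind₂i.const_mul C)) hpt
    _ = (C * ∫ Zm, S₁.indicator g₁ Zm) + C * ∫ Zm, S₂.indicator g₂ (Alexander.regFlow (Torus.geometry d) ε u Zm) := by
        rw [integral_add (hind₁i.const_mul C) (hind₂i.const_mul C), integral_const_mul, integral_const_mul]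
    _ ≤ C * (u * A * Real.exp (-(β / 2) * configEnergy W)) + C * (u * A * Real.exp (-(β / 2) * configEnergy W)) :=
        add_le_add (mul_le_mul_of_nonneg_left hI₁ hC) (mul_le_mul_of_nonneg_left hI₂ hC)
    _ = 2 * C * A * u * Real.exp (-(β / 2) * configEnergy W) := by ring

end Estimate

end

end Literature.MathematicalPhysics.KineticTheory
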